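import Literature.MathematicalPhysics.QuantumFieldTheory.Balaban1983to89.Beta.PlaquetteBackground

/-!
# `Beta.PlaquetteHessian` — the SYMMETRIC first-order Hessian operator of the Wilson action and its uniqueness:
# `wilsonHessOp := ½•(wilsonVertexOp + wilsonVertexOpᵀ)` is the unique symmetric matrix `H` with `−½·jet21 ℝ τ e (field t v) B = ½·vᵀHv` for all `v`

HONEST FRAMING (cell `pub-balaban`, β sub-cell, analysis prover AN3, generation 11, fifth node).  Discharging `BetaPertH`
would make Bałaban's ultraviolet stability UNCONDITIONAL — a real constructive-QFT result; it is NOT the continuum limit and NOT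
the Clay problem.  This file discharges nothing of the kind: it is FINITE REAL LINEAR ALGEBRA plus the bookkeeping of
`Beta.PlaquetteStencil` / `Beta.PlaquetteBackground`, kernel-checked.  Value = a kernel certificate for the β-function bookkeeping
(the cell's `(D1-rep)` dictionary «which term of the ACTUAL plaquette action produces which table coefficient»), NOT summit progress.

ABSOLUTE RULE.  No internally-minted statement enters as a cited fact; every statement below is kernel-proved; no literature is cited
(T. Bałaban, Comm. Math. Phys. **99** (1985) 389–434 [Balaban1985BackgroundPropagators] = cell paper B9, p. 392 (3.10): «it is a hermitian
operator given by the quadratic form ⟨A, ΔA⟩» is CONTEXT for why the SYMMETRIC representative is the one an operator-typed slot wants —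
nothing printed is a hypothesis).  The manuscripts under audit are not citable for their disputed steps and are not cited here.

WHY THIS FILE (an outside reader's note answered: XREAD C-pv20-46 on `PlaquetteStencil`, note R2).  `PlaquetteStencil.actionJet21_eq_wilsonVertex₁` and `PlaquetteBackground.actionJet21_eq_wilsonVertexOp`
identify the `B`-linear Wilson Hessian term as a quadratic form `½·vᵀMv` for ALL `v`; such an identity determines only `M + Mᵀ`, and the
assembled `M = wilsonVertexOp` is not symmetric.  An operator-typed consumer (a resolvent / Neumann expansion around the model operator) needs
ONE matrix.  This file supplies the canonical one and proves it is the only symmetric choice.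

WHAT IS PROVED.
* §1 REAL QUADRATIC-FORM ALGEBRA on a finite index type: `dotProduct_mulVec_comm_of_transpose` (`Sᵀ = S ⇒ vᵀSw = wᵀSv`),
  `dotProduct_transpose_mulVec` (`vᵀMᵀv = vᵀMv`), `symPart M := ½•(M + Mᵀ)` with `symPart_transpose`, `symPart_of_transpose_eq(_neg)`, `dotProduct_symPart_mulVec` (`vᵀ(symPart M)v = vᵀMv`),
  `symPart_add`, `symPart_sum`, the polarization identity `two_mul_dotProduct_mulVec`, and **`eq_of_transpose_eq_of_quadratic_eq`: two symmetric real
  matrices with the same quadratic form are equal** (entries recovered on `Pi.single` vectors).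
* §2 `wilsonHess₁ e z γ A := symPart (wilsonVertex₁ e z γ A)`, `wilsonHessOp e A := symPart (wilsonVertexOp e A)`, their symmetry, and
  `wilsonHessOp_eq_sum : wilsonHessOp e A = Σ_z Σ_γ wilsonHess₁ e z γ (A z γ)`.
* §3 **HEADLINES** `actionJet21_eq_wilsonHess₁` (one-bond background), `actionJet21_eq_wilsonHessOp` (every background):
  `−½·jet21 ℝ τ e (field t v) B = ½ · v ⬝ᵥ (wilsonHessOp e (fun z γ => adM τ t (B z γ)) *ᵥ v)`, and **UNIQUENESS `wilsonHessOp_unique`: if `Sᵀ = S`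
  and `−½·jet21 ℝ τ e (field t v) B = ½ · v ⬝ᵥ (S *ᵥ v)` for all `v`, then `S = wilsonHessOp e (fun z γ => adM τ t (B z γ))`** (tracial `τ`).
* §4 BAŁABAN'S LETTERS VERBATIM: `actionJet21_eq_wilsonHessOp_gen`, `wilsonHessOp_unique_gen` (`t = gen τ`, `τ = rntr`, background and fluctuation in
  coordinates, colour matrices `Σ_c b(z,c,γ) • ColourTrace.adMat τ (τ c)`); RIDERS answering the outside reader's notes on `PlaquetteBackground`
  (XREAD C-pv05g12-4 R1/R2): `adM_gen_smul_I : adM rntr (gen τ) (i•X) = adMat τ X` for EVERY `X`, `sum_smul_adMat` (ℝ-linearity of `adMat` in the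
  letter), and the same headline / uniqueness with colour matrices `adMat τ (Σ_c b(z,c,γ) • τ c)` (`actionJet21_eq_wilsonHessOp_adMat`,
  `wilsonHessOp_unique_adMat`).

NOT PROVED HERE, NOT CLAIMED: any estimate or table value of `wilsonHessOp`; the `(2,2)` family; anything about `BetaPertH`, the continuum limit
or the Clay problem.  All declarations are tagged `[folklore]`.
-/

namespace Literature.MathematicalPhysics.QuantumFieldTheory.Balaban1983to89.Beta.PlaquetteHessian

open Finset
open scoped BigOperators Matrix
open Literature.MathematicalPhysics.QuantumFieldTheory.Balaban1983to89.Beta.ColourTrace (adMat)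
open Literature.MathematicalPhysics.QuantumFieldTheory.Balaban1983to89.Beta.PlaquetteVertex
open Literature.MathematicalPhysics.QuantumFieldTheory.Balaban1983to89.Beta.PlaquetteStencil
open Literature.MathematicalPhysics.QuantumFieldTheory.Balaban1983to89.Beta.PlaquetteBackground

/-! ## §1 Real quadratic-form algebra -/

section QuadraticForms

variable {n : Type*} [Fintype n]

/-- a symmetric real matrix gives a symmetric bilinear pairing: `Sᵀ = S ⇒ vᵀSw = wᵀSv`. [folklore] -/
theorem dotProduct_mulVec_comm_of_transpose {S : Matrix n n ℝ} (hS : Sᵀ = S) (v w : n → ℝ) :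
    v ⬝ᵥ (S *ᵥ w) = w ⬝ᵥ (S *ᵥ v) := by
  have hs : ∀ i j, S j i = S i j := fun i j => by rw [← Matrix.transpose_apply S i j, hS]
  simp only [dotProduct, Matrix.mulVec, Finset.mul_sum]
  rw [Finset.sum_comm]
  refine Finset.sum_congr rfl fun j _ => Finset.sum_congr rfl fun i _ => ?_
  rw [hs i j]; ring

/-- the quadratic form does not see the antisymmetric part: `vᵀMᵀv = vᵀMv`. [folklore] -/
theorem dotProduct_transpose_mulVec (M : Matrix n n ℝ) (v : n → ℝ) : v ⬝ᵥ (Mᵀ *ᵥ v) = v ⬝ᵥ (M *ᵥ v) := by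
  simp only [dotProduct, Matrix.mulVec, Matrix.transpose_apply, Finset.mul_sum]
  rw [Finset.sum_comm]
  exact Finset.sum_congr rfl fun i _ => Finset.sum_congr rfl fun j _ => by ring

/-- **THE SYMMETRIC PART** `symPart M := ½•(M + Mᵀ)`.  A definition asserting nothing. [folklore] -/
noncomputable def symPart (M : Matrix n n ℝ) : Matrix n n ℝ := (2 : ℝ)⁻¹ • (M + Mᵀ)

omit [Fintype n] in
/-- the symmetric part is symmetric. [folklore] -/
theorem symPart_transpose (M : Matrix n n ℝ) : (symPart M)ᵀ = symPart M := by
  rw [symPart, Matrix.transpose_smul, Matrix.transpose_add, Matrix.transpose_transpose, add_comm]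

omit [Fintype n] in
/-- the symmetric part of a symmetric matrix is itself. [folklore] -/
theorem symPart_of_transpose_eq {S : Matrix n n ℝ} (hS : Sᵀ = S) : symPart S = S := by
  rw [symPart, hS, ← two_smul ℝ S, smul_smul, inv_mul_cancel₀ (two_ne_zero' ℝ), one_smul]

omit [Fintype n] in
/-- the symmetric part of an antisymmetric matrix vanishes. [folklore] -/
theorem symPart_of_transpose_eq_neg {A : Matrix n n ℝ} (hA : Aᵀ = -A) : symPart A = 0 := by
  rw [symPart, hA, add_neg_cancel, smul_zero]

omit [Fintype n] in
/-- the symmetric part is additive. [folklore] -/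
theorem symPart_add (M M' : Matrix n n ℝ) : symPart (M + M') = symPart M + symPart M' := by
  rw [symPart, symPart, symPart, Matrix.transpose_add, ← smul_add]
  congr 1
  abel

omit [Fintype n] in
/-- the symmetric part of a finite sum. [folklore] -/
theorem symPart_sum {ι : Type*} (s : Finset ι) (M : ι → Matrix n n ℝ) : symPart (∑ i ∈ s, M i) = ∑ i ∈ s, symPart (M i) := by
  rw [symPart, Matrix.transpose_sum, ← Finset.sum_add_distrib, Finset.smul_sum]
  rfl

/-- the symmetric part has the same quadratic form: `vᵀ(symPart M)v = vᵀMv`. [folklore] -/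
theorem dotProduct_symPart_mulVec (M : Matrix n n ℝ) (v : n → ℝ) : v ⬝ᵥ (symPart M *ᵥ v) = v ⬝ᵥ (M *ᵥ v) := by
  rw [symPart, Matrix.smul_mulVec, dotProduct_smul, Matrix.add_mulVec, dotProduct_add, dotProduct_transpose_mulVec, smul_eq_mul]
  ring

/-- POLARIZATION for a symmetric matrix: `2·vᵀSw = (v+w)ᵀS(v+w) − vᵀSv − wᵀSw`. [folklore] -/
theorem two_mul_dotProduct_mulVec {S : Matrix n n ℝ} (hS : Sᵀ = S) (v w : n → ℝ) :
    2 * (v ⬝ᵥ (S *ᵥ w)) = (v + w) ⬝ᵥ (S *ᵥ (v + w)) - v ⬝ᵥ (S *ᵥ v) - w ⬝ᵥ (S *ᵥ w) := by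
  rw [Matrix.mulVec_add, add_dotProduct, dotProduct_add, dotProduct_add, dotProduct_mulVec_comm_of_transpose hS w v]
  ring

/-- an entry of a matrix as a pairing of coordinate vectors: `e_iᵀ M e_j = M i j`. [folklore] -/
theorem single_dotProduct_mulVec_single [DecidableEq n] (M : Matrix n n ℝ) (i j : n) :
    Pi.single i (1 : ℝ) ⬝ᵥ (M *ᵥ Pi.single j 1) = M i j := by
  simp [dotProduct, Matrix.mulVec, Pi.single_apply, ite_mul, mul_ite]

/-- **TWO SYMMETRIC REAL MATRICES WITH THE SAME QUADRATIC FORM ARE EQUAL.** [folklore] -/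
theorem eq_of_transpose_eq_of_quadratic_eq {S T : Matrix n n ℝ} (hS : Sᵀ = S) (hT : Tᵀ = T)
    (h : ∀ v, v ⬝ᵥ (S *ᵥ v) = v ⬝ᵥ (T *ᵥ v)) : S = T := by
  classical
  have hB : ∀ v w : n → ℝ, v ⬝ᵥ (S *ᵥ w) = v ⬝ᵥ (T *ᵥ w) := by
    intro v w
    have h2 := two_mul_dotProduct_mulVec hS v w
    rw [h, h, h, ← two_mul_dotProduct_mulVec hT v w] at h2
    linarith
  ext i j
  rw [← single_dotProduct_mulVec_single S i j, ← single_dotProduct_mulVec_single T i j, hB]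

/-- **UNIQUENESS OF THE SYMMETRIC REPRESENTATIVE**: a symmetric `S` with the quadratic form of `M` is `symPart M`. [folklore] -/
theorem eq_symPart_of_quadratic_eq {S : Matrix n n ℝ} (M : Matrix n n ℝ) (hS : Sᵀ = S)
    (h : ∀ v, v ⬝ᵥ (S *ᵥ v) = v ⬝ᵥ (M *ᵥ v)) : S = symPart M :=
  eq_of_transpose_eq_of_quadratic_eq hS (symPart_transpose M) fun v => by rw [h, dotProduct_symPart_mulVec]

end QuadraticForms

/-! ## §2 The symmetric one-bond vertex and the symmetric vertex operator -/

section Operators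

variable {Λ : Type*} [DecidableEq Λ] [AddCommGroup Λ] {C : Type*} {D : Type*} [Fintype D] [DecidableEq D]

/-- **THE SYMMETRIC ONE-BOND FIRST-ORDER HESSIAN VERTEX** `wilsonHess₁ e z γ A := symPart (wilsonVertex₁ e z γ A)`.  A definition asserting nothing.
[folklore] -/
noncomputable def wilsonHess₁ (e : D → Λ) (z : Λ) (γ : D) (A : Matrix C C ℝ) : Matrix (Λ × (C × D)) (Λ × (C × D)) ℝ :=
  symPart (wilsonVertex₁ e z γ A)

variable [Fintype Λ]

/-- **THE SYMMETRIC FIRST-ORDER HESSIAN OPERATOR** `wilsonHessOp e A := symPart (wilsonVertexOp e A)`.  A definition asserting nothing. [folklore] -/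
noncomputable def wilsonHessOp (e : D → Λ) (A : Λ → D → Matrix C C ℝ) : Matrix (Λ × (C × D)) (Λ × (C × D)) ℝ :=
  symPart (wilsonVertexOp e A)

omit [Fintype Λ] in
/-- the symmetric one-bond vertex is symmetric. [folklore] -/
theorem wilsonHess₁_transpose (e : D → Λ) (z : Λ) (γ : D) (A : Matrix C C ℝ) :
    (wilsonHess₁ e z γ A)ᵀ = wilsonHess₁ e z γ A :=
  symPart_transpose _

/-- the symmetric operator is symmetric. [folklore] -/
theorem wilsonHessOp_transpose (e : D → Λ) (A : Λ → D → Matrix C C ℝ) : (wilsonHessOp e A)ᵀ = wilsonHessOp e A :=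
  symPart_transpose _

/-- the symmetric operator is the bond-by-bond sum of the symmetric one-bond vertices. [folklore] -/
theorem wilsonHessOp_eq_sum (e : D → Λ) (A : Λ → D → Matrix C C ℝ) :
    wilsonHessOp e A = ∑ z, ∑ γ, wilsonHess₁ e z γ (A z γ) := by
  rw [wilsonHessOp, wilsonVertexOp, symPart_sum]
  exact Finset.sum_congr rfl fun z _ => symPart_sum _ _

end Operators

/-! ## §3 Headlines and uniqueness -/

section Headline

variable {𝔸 : Type*} [NormedRing 𝔸] [NormedAlgebra ℝ 𝔸]
variable {Λ : Type*} [Fintype Λ] [DecidableEq Λ] [AddCommGroup Λ] {C : Type*} [Fintype C]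
  {D : Type*} [Fintype D] [DecidableEq D]

/-- **ONE-BOND HEADLINE, SYMMETRIC FORM**: `−½·jet21 ℝ τ e (field t v) (bondLetter z γ Y) = ½ · v ⬝ᵥ (wilsonHess₁ e z γ (adM τ t Y) *ᵥ v)`
(tracial `τ`, all `v`). [folklore] -/
theorem actionJet21_eq_wilsonHess₁ (τ : 𝔸 →ₗ[ℝ] ℝ) (hτ : ∀ a b : 𝔸, τ (a * b) = τ (b * a)) (t : C → 𝔸) (e : D → Λ)
    (v : Λ × (C × D) → ℝ) (z : Λ) (γ : D) (Y : 𝔸) :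
    -((2 : ℝ)⁻¹ * jet21 ℝ τ e (field t v) (bondLetter z γ Y)) = (2 : ℝ)⁻¹ * (v ⬝ᵥ (wilsonHess₁ e z γ (adM τ t Y) *ᵥ v)) := by
  rw [wilsonHess₁, dotProduct_symPart_mulVec, actionJet21_eq_wilsonVertex₁ τ hτ]

/-- **HEADLINE — THE SYMMETRIC FIRST-ORDER HESSIAN OPERATOR FOR EVERY BACKGROUND**:
`−½·jet21 ℝ τ e (field t v) B = ½ · v ⬝ᵥ (wilsonHessOp e (fun z γ => adM τ t (B z γ)) *ᵥ v)` (tracial `τ`, every `B`, every `v`). [folklore] -/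
theorem actionJet21_eq_wilsonHessOp (τ : 𝔸 →ₗ[ℝ] ℝ) (hτ : ∀ a b : 𝔸, τ (a * b) = τ (b * a)) (t : C → 𝔸) (e : D → Λ)
    (v : Λ × (C × D) → ℝ) (B : Λ → D → 𝔸) :
    -((2 : ℝ)⁻¹ * jet21 ℝ τ e (field t v) B) = (2 : ℝ)⁻¹ * (v ⬝ᵥ (wilsonHessOp e (fun z γ => adM τ t (B z γ)) *ᵥ v)) := by
  rw [wilsonHessOp, dotProduct_symPart_mulVec, actionJet21_eq_wilsonVertexOp τ hτ]

/-- **UNIQUENESS — THE SYMMETRIC HESSIAN OPERATOR IS DETERMINED BY THE ACTION**: if `S` is symmetric and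
`−½·jet21 ℝ τ e (field t v) B = ½ · v ⬝ᵥ (S *ᵥ v)` for every fluctuation `v`, then `S = wilsonHessOp e (fun z γ => adM τ t (B z γ))`
(tracial `τ`). [folklore] -/
theorem wilsonHessOp_unique (τ : 𝔸 →ₗ[ℝ] ℝ) (hτ : ∀ a b : 𝔸, τ (a * b) = τ (b * a)) (t : C → 𝔸) (e : D → Λ)
    (B : Λ → D → 𝔸) {S : Matrix (Λ × (C × D)) (Λ × (C × D)) ℝ} (hS : Sᵀ = S)
    (h : ∀ v : Λ × (C × D) → ℝ, -((2 : ℝ)⁻¹ * jet21 ℝ τ e (field t v) B) = (2 : ℝ)⁻¹ * (v ⬝ᵥ (S *ᵥ v))) :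
    S = wilsonHessOp e (fun z γ => adM τ t (B z γ)) := by
  unfold wilsonHessOp
  refine eq_symPart_of_quadratic_eq _ hS fun v => ?_
  have h1 := h v
  rw [actionJet21_eq_wilsonVertexOp τ hτ] at h1
  linarith

/-- the same uniqueness at a one-bond background: `S = wilsonHess₁ e z γ (adM τ t Y)`. [folklore] -/
theorem wilsonHess₁_unique (τ : 𝔸 →ₗ[ℝ] ℝ) (hτ : ∀ a b : 𝔸, τ (a * b) = τ (b * a)) (t : C → 𝔸) (e : D → Λ)
    (z : Λ) (γ : D) (Y : 𝔸) {S : Matrix (Λ × (C × D)) (Λ × (C × D)) ℝ} (hS : Sᵀ = S)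
    (h : ∀ v : Λ × (C × D) → ℝ, -((2 : ℝ)⁻¹ * jet21 ℝ τ e (field t v) (bondLetter z γ Y)) = (2 : ℝ)⁻¹ * (v ⬝ᵥ (S *ᵥ v))) :
    S = wilsonHess₁ e z γ (adM τ t Y) := by
  unfold wilsonHess₁
  refine eq_symPart_of_quadratic_eq _ hS fun v => ?_
  have h1 := h v
  rw [actionJet21_eq_wilsonVertex₁ τ hτ] at h1
  linarith

/-- the symmetric operator with the background in coordinates `B = field t b`:
`−½·jet21 ℝ τ e (field t v) (field t b) = ½ · v ⬝ᵥ (wilsonHessOp e (fun z γ => Σ_c b(z,c,γ) • adM τ t (t c)) *ᵥ v)`. [folklore] -/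
theorem actionJet21_eq_wilsonHessOp_field (τ : 𝔸 →ₗ[ℝ] ℝ) (hτ : ∀ a b : 𝔸, τ (a * b) = τ (b * a)) (t : C → 𝔸) (e : D → Λ)
    (v b : Λ × (C × D) → ℝ) :
    -((2 : ℝ)⁻¹ * jet21 ℝ τ e (field t v) (field t b)) =
      (2 : ℝ)⁻¹ * (v ⬝ᵥ (wilsonHessOp e (fun z γ => ∑ c, b (z, (c, γ)) • adM τ t (t c)) *ᵥ v)) := by
  rw [actionJet21_eq_wilsonHessOp τ hτ]
  simp only [adM_field]

end Headline

/-! ## §4 Bałaban's letters verbatim -/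

section BalabanLetters

open ColourTrace

attribute [local instance] Matrix.linftyOpNormedRing Matrix.linftyOpNormedAlgebra

variable {N : ℕ} {C : Type*} [Fintype C]
variable {Λ : Type*} [Fintype Λ] [DecidableEq Λ] [AddCommGroup Λ] {D : Type*} [Fintype D] [DecidableEq D]

/-- **BAŁABAN'S LETTERS VERBATIM**: `−½·jet21 ℝ rntr e (field (gen τ) v) (field (gen τ) b) = ½ · v ⬝ᵥ (wilsonHessOp e (fun z γ => Σ_c b(z,c,γ) •
ColourTrace.adMat τ (τ c)) *ᵥ v)` — the symmetric first-order Hessian operator for background coordinates `b` (no hypothesis on the generator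
family; local Matrix norm instances as in `PlaquetteVertex` §4). [folklore] -/
theorem actionJet21_eq_wilsonHessOp_gen (τ : C → Matrix (Fin N) (Fin N) ℂ) (e : D → Λ) (v b : Λ × (C × D) → ℝ) :
    -((2 : ℝ)⁻¹ * jet21 ℝ rntr e (field (gen τ) v) (field (gen τ) b)) =
      (2 : ℝ)⁻¹ * (v ⬝ᵥ (wilsonHessOp e (fun z γ => ∑ c, b (z, (c, γ)) • adMat τ (τ c)) *ᵥ v)) := by
  rw [actionJet21_eq_wilsonHessOp rntr rntr_comm (gen τ) e v (field (gen τ) b)]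
  simp only [adM_field_gen]

/-- **UNIQUENESS IN BAŁABAN'S LETTERS**: a symmetric `S` with `−½·jet21 = ½ · vᵀSv` for all `v` at background coordinates `b` equals
`wilsonHessOp e (fun z γ => Σ_c b(z,c,γ) • adMat τ (τ c))`. [folklore] -/
theorem wilsonHessOp_unique_gen (τ : C → Matrix (Fin N) (Fin N) ℂ) (e : D → Λ) (b : Λ × (C × D) → ℝ)
    {S : Matrix (Λ × (C × D)) (Λ × (C × D)) ℝ} (hS : Sᵀ = S)
    (h : ∀ v : Λ × (C × D) → ℝ, -((2 : ℝ)⁻¹ * jet21 ℝ rntr e (field (gen τ) v) (field (gen τ) b)) = (2 : ℝ)⁻¹ * (v ⬝ᵥ (S *ᵥ v))) :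
    S = wilsonHessOp e (fun z γ => ∑ c, b (z, (c, γ)) • adMat τ (τ c)) := by
  unfold wilsonHessOp
  refine eq_symPart_of_quadratic_eq _ hS fun v => ?_
  have h1 := h v
  rw [actionJet21_eq_wilsonVertexOp_gen] at h1
  linarith

omit [Fintype C] in
/-- RIDER (outside reader's note XREAD C-pv05g12-4 R1): for EVERY complex matrix `X` the colour matrix of the letter `i•X` in the family
`gen τ` is `ColourTrace.adMat τ X` — `adM rntr (gen τ) (i•X) = adMat τ X` (tree `PlaquetteVertex.adM_gen` is the case `X = τ c`; cyclicity of
the trace only, no hypothesis on the family). [folklore] -/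
theorem adM_gen_smul_I (τ : C → Matrix (Fin N) (Fin N) ℂ) (X : Matrix (Fin N) (Fin N) ℂ) :
    adM rntr (gen τ) (Complex.I • X) = adMat τ X := by
  ext a b
  rw [adM_apply, adMat_apply, rntr_eq_ntr_re]
  congr 1
  simp only [gen, SpinTable.br, adMatC, Matrix.of_apply, ntr, ibr, Matrix.smul_mul, Matrix.mul_smul, smul_sub, Matrix.mul_sub,
    smul_smul, Complex.I_mul_I, Matrix.trace_smul, Matrix.trace_sub, smul_eq_mul]
  have h1 : (τ a * (X * τ b)).trace = (X * (τ b * τ a)).trace := by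
    rw [← Matrix.mul_assoc, Matrix.trace_mul_comm, ← Matrix.mul_assoc, Matrix.trace_mul_comm]
  have h2 : (τ a * (τ b * X)).trace = (X * (τ a * τ b)).trace := by
    rw [← Matrix.mul_assoc, Matrix.trace_mul_comm]
  rw [h1, h2]
  ring

omit [Fintype C] in
/-- RIDER (XREAD C-pv05g12-4 R2): `ℝ`-linearity of `ColourTrace.adMat` in the letter — `Σ_{c∈s} β_c • adMat τ (F c) = adMat τ (Σ_{c∈s} β_c • F c)`
(through `adM_gen_smul_I` and `PlaquetteBackground.adM_sum_smul`). [folklore] -/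
theorem sum_smul_adMat {ι : Type*} (τ : C → Matrix (Fin N) (Fin N) ℂ) (s : Finset ι) (β : ι → ℝ)
    (F : ι → Matrix (Fin N) (Fin N) ℂ) :
    ∑ c ∈ s, β c • adMat τ (F c) = adMat τ (∑ c ∈ s, β c • F c) := by
  rw [← adM_gen_smul_I τ (∑ c ∈ s, β c • F c), Finset.smul_sum]
  simp_rw [smul_comm Complex.I]
  rw [adM_sum_smul]
  simp_rw [adM_gen_smul_I]

/-- the symmetric operator with the colour matrices written `adMat τ (X_γ(z))` for the HERMITIAN-SIDE letter field `X_γ(z) := Σ_c b(z,c,γ) • τ c`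
(the background is `field (gen τ) b = (z, γ) ↦ i•X_γ(z)`; convention: `b` = tr-coordinates of `B/i`). [folklore] -/
theorem actionJet21_eq_wilsonHessOp_adMat (τ : C → Matrix (Fin N) (Fin N) ℂ) (e : D → Λ) (v b : Λ × (C × D) → ℝ) :
    -((2 : ℝ)⁻¹ * jet21 ℝ rntr e (field (gen τ) v) (field (gen τ) b)) =
      (2 : ℝ)⁻¹ * (v ⬝ᵥ (wilsonHessOp e (fun z γ => adMat τ (∑ c, b (z, (c, γ)) • τ c)) *ᵥ v)) := by
  rw [actionJet21_eq_wilsonHessOp_gen]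
  simp_rw [sum_smul_adMat]

/-- uniqueness with the colour matrices written `adMat τ (Σ_c b(z,c,γ) • τ c)`. [folklore] -/
theorem wilsonHessOp_unique_adMat (τ : C → Matrix (Fin N) (Fin N) ℂ) (e : D → Λ) (b : Λ × (C × D) → ℝ)
    {S : Matrix (Λ × (C × D)) (Λ × (C × D)) ℝ} (hS : Sᵀ = S)
    (h : ∀ v : Λ × (C × D) → ℝ, -((2 : ℝ)⁻¹ * jet21 ℝ rntr e (field (gen τ) v) (field (gen τ) b)) = (2 : ℝ)⁻¹ * (v ⬝ᵥ (S *ᵥ v))) :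
    S = wilsonHessOp e (fun z γ => adMat τ (∑ c, b (z, (c, γ)) • τ c)) := by
  have hu := wilsonHessOp_unique_gen τ e b hS h
  simp_rw [sum_smul_adMat] at hu
  exact hu

end BalabanLetters

/-! ## §5 Sanity examples -/

section Examples

/-- an antisymmetric matrix has zero symmetric part (instance of `symPart_of_transpose_eq_neg`): the quadratic form is blind to it. [folklore] -/
example {n : Type*} (A : Matrix n n ℝ) (hA : Aᵀ = -A) : symPart A = 0 := symPart_of_transpose_eq_neg hA

/-- a symmetric matrix is its own symmetric part (instance of `symPart_of_transpose_eq`). [folklore] -/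
example {n : Type*} (S : Matrix n n ℝ) (hS : Sᵀ = S) : symPart S = S := symPart_of_transpose_eq hS

end Examples

end Literature.MathematicalPhysics.QuantumFieldTheory.Balaban1983to89.Beta.PlaquetteHessian
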